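import Summits.CriticalPhenomena.PercolationContinuityZ3.Theorems.Transplant.KNCells2CorridorO
import Summits.CriticalPhenomena.PercolationContinuityZ3.Theorems.Transplant.KNCells2KitAtRunO
import Summits.CriticalPhenomena.PercolationContinuityZ3.Theorems.Transplant.SkelPhiFaceResidueF
import Summits.CriticalPhenomena.PercolationContinuityZ3.Theorems.Transplant.SkelRootSeedLawF
import Summits.CriticalPhenomena.PercolationContinuityZ3.Theorems.Transplant.SkelKitResiduesHabN
import HarnessLib

/-!
# N2 (the frames-only node `SamePDropOfSkeletonFrm₁`, OPEN), (c2) residue layer: THE THREE RESIDUES IN THEIR N2 SHAPES AND THE PACKAGING TO `KSchA.KitAtRunO` —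
# `Skel.ReachOblAtHNF/ReachOblRHNOF` (corridor: oriented run quantifiers, (S0) kits), `Skelφ.FaceOblRMOF` (face: per-face window map over hp-8's `FaceOblAtMF`), the
# source-separated (S0) corridor estimate `KNCells.KSchA.hreach_of_chain_src_subOF` / `Skel.reach_of_reachOblAtHNF_src`, and **`Skelφ.kitAtRunO_of_oblRHNMWF_src`**

C2-SPEC §2 (HOME/prim-bschramm-p3-g15/C2-SPEC.md). Rulings used: (R-13) (S0) kits `TStep.KitsAtF`; (R-18) oriented macro layer at `qNE` (stmt's O-ports `Valid₂O/IsRun₂O/astOf₂O/onwardO/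
aOf₁O/aOf₂O`, `lt_real_reachB_WcorO`, `KSchA.KitAtRunO`); J4 (root input at forward directions: `Skel.RootOblTWF`, p340132); the face residue's body is hp-8 g39's `Skelφ.FaceOblAtMF`
(SkelPhiFaceResidueF p340582) with its one-step packaging `cond_of_faceOblAtMF`.  Texts = N1's SkelKitResiduesHabN :61–:139 / SkelNeg1ChoiceO §0 / SkelNeg1ClosureA §0 with exactly
these edits.
builds on p205010 (kernel theorem, internal audit signed; external expert review pending) — nothing in this file uses p205010; the node stays OPEN.
Lane `prim-bschramm`, seat `prim-bschramm-p3` (gen 15; N2 design owner); helper file (`--supports stmt-CriticalPhenomena-4575 --as helper`).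
* §1 `KNCells.KSchA.hreach_of_chain_src_subOF` (Lemma 12 over cells: source at `S.δc` under `Wcor`, (S0) kits at an unrelated `δ`, oriented validity);
* §2 `Skel.ReachOblAtHNF`, `Skel.ReachOblRHNOF` (+ `.mono`), `Skel.reach_of_reachOblAtHNF_src`;
* §3 `Skelφ.FaceOblRMOF`; **`Skelφ.kitAtRunO_of_oblRHNMWF_src`**: `RootOblTWF` + `FaceOblRMOF` + `ReachOblRHNOF nmax` + the (S0) one-step / corridor / root chain properties ⟹ `KitAtRunO`.
[cite: KozmaNitzan2024, §4 p. 28 ((32)), p. 30 (Steps III–IV), Lemmas 10–12 (pp. 17–25)]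
-/

noncomputable section

open MeasureTheory ProbabilityTheory
open scoped ENNReal Classical

namespace Summit.CriticalPhenomena.PercolationContinuityZ3.Theorems

namespace Transplant

/-! ## §1 The source-separated (S0) corridor estimate over oriented validity -/

namespace KNCells.KSchA

open Literature.Probability.Percolation Literature.Probability.LatticeModels SimpleGraph GadgetSystem ProbeHistory HSiteScheme Contour

variable {V : Type} [DecidableEq V] [Countable V] {A : Type*} {G : SimpleGraph V} [G.LocallyFinite] {S : KSchA V A} {FD : FaceData V A}
variable {h : ProbeHistory V} {e : Site 2 × MDir} {a' : A} {du : MDir}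

/-- **Lemma 12 over cells with enlarged targets ⟹ `hreach`, SOURCE-SEPARATED, (S0) kits, oriented validity**: as `hreach_of_chain_edge_subO` (stmt's twin of
KNCells2CorridorEdge :75) but the chain hypothesis takes the source at the scheme threshold `1 − S.δc` (KN's (32) under `Wcor`) and the kits in the (S0) shape
`KitsAtF` at an unrelated accuracy `δ` — text of `hreach_of_chain_src_sub` (SkelNeg1ClosureA :52) with `Valid₂ ↦ Valid₂O`, `aOf₁ ↦ aOf₁O`, `KitsAt ↦ KitsAtF`.
[cite: KozmaNitzan2024, §4 Lemma 12 (pp. 23–25), p. 30 (Step IV)] -/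
theorem hreach_of_chain_src_subOF (G' : SimpleGraph V) [G'.LocallyFinite] (hV : S.Valid₂O G h e) {Δ' : ℕ} {δ ε'' η : ℝ} {n : ℕ}
    (hchain : ∀ (W : Sym2 V → unitInterval) (s : Fin (n + 1) → KNLevels.TStep G') (T' : Fin (n + 1) → Finset V) (η : ℝ),
      (∀ i : Fin (n + 1), (s i).L.o = (s 0).L.o) →
      (∀ i : Fin n, T' (Fin.castSucc i) ⊆ (s i.succ).L.X 0) →
      (∀ i : Fin (n + 1), T' i ⊆ (s i).T) →
      (∀ i : Fin (n + 1), (s i).KitsAtF W S.p Δ' δ) →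
      η ≤ δ / 2 →
      (∀ i : Fin (n + 1), (prodBernoulli W).real (⋃ t ∈ (s i).T \ T' i, openConn (s 0).L.o t) ≤ η) →
      1 - S.δc < (prodBernoulli W).real (s 0).L.reachB →
        1 - ε'' < (prodBernoulli W).real (⋃ t ∈ T' (Fin.last n), openConn (s 0).L.o t))
    (s : Fin (n + 1) → KNLevels.TStep G') (T' : Fin (n + 1) → Finset V) (ho : ∀ i : Fin (n + 1), (s i).L.o = S.Γ.root)
    (hlink : ∀ i : Fin n, T' (Fin.castSucc i) ⊆ (s i.succ).L.X 0) (hsub : ∀ i : Fin (n + 1), T' i ⊆ (s i).T)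
    (hkits : ∀ i : Fin (n + 1), (s i).KitsAtF (S.Wcor G FD h e (S.aOf₁O G h e) a' du) S.p Δ' δ) (hη : η ≤ δ / 2)
    (hexc : ∀ i : Fin (n + 1), (prodBernoulli (S.Wcor G FD h e (S.aOf₁O G h e) a' du)).real
      (⋃ t ∈ (s i).T \ T' i, openConn S.Γ.root t) ≤ η)
    (hB0 : S.Γ.M (S.aOf₁O G h e) (tgt e) ⊆ (s 0).L.X 0) (hTn : T' (Fin.last n) ⊆ S.Γ.M a' (tgt e + stepVec du)) :
    1 - ε'' < (prodBernoulli (S.Wfull G h e (S.aOf₁O G h e) a' du)).real (S.Reach G FD h e (S.aOf₁O G h e) a' du) := by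
  set α := S.aOf₁O G h e with hα
  have hroot : S.Γ.root ∈ S.Ucor G FD h e α a' du := Finset.mem_union_left _ (Finset.mem_union_left _ hV.root_mem)
  have ho' : ∀ i : Fin (n + 1), (s i).L.o = (s 0).L.o := fun i => by rw [ho i, ho 0]
  have hsrc : 1 - S.δc < (prodBernoulli (S.Wcor G FD h e α a' du)).real (s 0).L.reachB := by
    have := lt_real_reachB_WcorO hV hroot hB0 (a' := a') (du := du)
    rw [KNLevels.LData.reachB, ho 0]
    exact this
  have hexc' : ∀ i : Fin (n + 1), (prodBernoulli (S.Wcor G FD h e α a' du)).real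
      (⋃ t ∈ (s i).T \ T' i, openConn (s 0).L.o t) ≤ η := fun i => by rw [ho 0]; exact hexc i
  have hc := hchain _ s T' η ho' hlink hsub hkits hη hexc' hsrc
  rw [ho 0, Wcor, ← Finset.set_biUnion_coe, prodBernoulli_restrW_real_biUnion_openConn _ _ (Finset.mem_coe.2 hroot)] at hc
  refine hc.trans_le (measureReal_mono ?_ (measure_ne_top _ _))
  rw [Reach, Ucor]
  exact biUnion_openConnIn_mono subset_rfl _ (Finset.coe_subset.2 hTn)

end KNCells.KSchA

/-! ## §2 The corridor residue: (S0) kits, oriented anchors and run quantifiers -/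

namespace Skel

open Literature.Probability.Percolation Literature.Probability.LatticeModels SimpleGraph KNCells KNLevels
open GadgetSystem ProbeHistory HSiteScheme Contour

variable {V : Type} [DecidableEq V] [Countable V] (G : SimpleGraph V) [G.LocallyFinite] {A : Type*}

/-- **The corridor obligation at one probe, (S0) kits, oriented anchors** (C2-SPEC §2: body of `ReachOblAtHN`, SkelKitResiduesHabN :61–:72, with `KitsAt ↦ KitsAtF`,
`aOf₁ ↦ aOf₁O`). [cite: KozmaNitzan2024, §4 Lemma 12 (pp. 23–25), p. 30 (Step IV)] -/
def ReachOblAtHNF (nmax : ℕ) (S : KSchA V A) (FD : FaceData V A) (Δ' : ℕ) (δ : ℝ) (h : ProbeHistory V) (e : Site 2 × MDir) (a' : A)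
    (du : MDir) : Prop :=
  ∃ (n : ℕ) (_ : n ≤ nmax) (Ω : Finset V) (s : Fin (n + 1) → KNLevels.TStep (winGraphIn G Ω)) (T' : Fin (n + 1) → Finset V) (η : ℝ),
    (∀ i : Fin (n + 1), (s i).L.o = S.Γ.root) ∧
    (∀ i : Fin n, T' (Fin.castSucc i) ⊆ (s i.succ).L.X 0) ∧ (∀ i : Fin (n + 1), T' i ⊆ (s i).T) ∧
    (∀ i : Fin (n + 1), (s i).KitsAtF (S.Wcor G FD h e (S.aOf₁O G h e) a' du) S.p Δ' δ) ∧ η ≤ δ / 2 ∧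
    (∀ i : Fin (n + 1), (prodBernoulli (S.Wcor G FD h e (S.aOf₁O G h e) a' du)).real (⋃ t ∈ (s i).T \ T' i, openConn S.Γ.root t) ≤ η) ∧
    S.Γ.M (S.aOf₁O G h e) (tgt e) ⊆ (s 0).L.X 0 ∧
    T' (Fin.last n) ⊆ S.Γ.M a' (tgt e + stepVec du)

/-- **The corridor obligations, run-restricted ORIENTED form, (S0) kits, chain length `≤ nmax`** (C2-SPEC §2) — the (C) column's N2 target at `a' = aOf₂O`.
[cite: KozmaNitzan2024, §4 p. 30 (Step IV), Lemma 12 (pp. 23–25)] -/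
def ReachOblRHNOF (nmax : ℕ) (S : KSchA V A) (FD : FaceData V A) (Δ' : ℕ) (δ : ℝ) : Prop :=
  ∀ h e, S.IsRun₂O G h → (S.astOf₂O G h).st.ochoice KSchA.qNE = some e → S.Valid₂O G h e →
    ∀ du ∈ S.onwardO G h (tgt e), ReachOblAtHNF G nmax S FD Δ' δ h e (S.aOf₂O G h e) du

variable {G}
variable {S : KSchA V A} {FD : FaceData V A} {h : ProbeHistory V} {e : Site 2 × MDir} {a' : A} {du : MDir}

omit [Countable V] in
/-- A longer budget serves. [folklore] -/
theorem ReachOblAtHNF.mono {nmax nmax' : ℕ} (hle : nmax ≤ nmax') {Δ' : ℕ} {δ : ℝ} (hR : ReachOblAtHNF G nmax S FD Δ' δ h e a' du) :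
    ReachOblAtHNF G nmax' S FD Δ' δ h e a' du := by
  obtain ⟨n, hn, Ω, s, T', η, hrest⟩ := hR
  exact ⟨n, hn.trans hle, Ω, s, T', η, hrest⟩

omit [Countable V] in
/-- A longer budget serves, run-restricted form. [folklore] -/
theorem ReachOblRHNOF.mono {nmax nmax' : ℕ} (hle : nmax ≤ nmax') {Δ' : ℕ} {δ : ℝ} (hR : ReachOblRHNOF G nmax S FD Δ' δ) :
    ReachOblRHNOF G nmax' S FD Δ' δ :=
  fun h e hrun hc hV du hdu => (hR h e hrun hc hV du hdu).mono hle

/-- **`ReachOblAtHNF G nmax` + the (S0) chain properties of every length `n ≤ nmax`, SOURCE at the scheme threshold, kits at `δ`, in every habitat window graph ⟹ the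
corridor bound `1 − ε'' < P_{Wfull}(Reach)`** (`hreach_of_chain_src_subOF`). [cite: KozmaNitzan2024, §4 Lemma 12 (pp. 23–25), p. 30 (Step IV)] -/
theorem reach_of_reachOblAtHNF_src {nmax : ℕ} (hV : S.Valid₂O G h e) {Δ' : ℕ} {δ ε'' : ℝ}
    (hchain : ∀ n ≤ nmax, ∀ (Ω : Finset V) (Wg : Sym2 V → unitInterval) (s : Fin (n + 1) → KNLevels.TStep (winGraphIn G Ω))
      (T' : Fin (n + 1) → Finset V) (η : ℝ),
      (∀ i : Fin (n + 1), (s i).L.o = (s 0).L.o) →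
      (∀ i : Fin n, T' (Fin.castSucc i) ⊆ (s i.succ).L.X 0) →
      (∀ i : Fin (n + 1), T' i ⊆ (s i).T) →
      (∀ i : Fin (n + 1), (s i).KitsAtF Wg S.p Δ' δ) →
      η ≤ δ / 2 →
      (∀ i : Fin (n + 1), (prodBernoulli Wg).real (⋃ t ∈ (s i).T \ T' i, openConn (s 0).L.o t) ≤ η) →
      1 - S.δc < (prodBernoulli Wg).real (s 0).L.reachB →
        1 - ε'' < (prodBernoulli Wg).real (⋃ t ∈ T' (Fin.last n), openConn (s 0).L.o t))
    (hR : ReachOblAtHNF G nmax S FD Δ' δ h e a' du) :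
    1 - ε'' < (prodBernoulli (S.Wfull G h e (S.aOf₁O G h e) a' du)).real (S.Reach G FD h e (S.aOf₁O G h e) a' du) := by
  obtain ⟨n, hn, Ω, s, T', η, ho, hlink, hsub, hkits, hη, hexc, hB0, hTn⟩ := hR
  exact KNCells.KSchA.hreach_of_chain_src_subOF (winGraphIn G Ω) hV (hchain n hn Ω) s T' ho hlink hsub hkits hη hexc hB0 hTn

end Skel

/-! ## §3 The face residue's run-restricted oriented form, and the packaging to `KitAtRunO` -/

namespace Skelφ

open Literature.Probability.Percolation Literature.Probability.LatticeModels SimpleGraph KNCells KNLevels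
open GadgetSystem ProbeHistory HSiteScheme Contour
open Skel (winGraph winGraphIn)

variable {V : Type} [DecidableEq V] [Countable V] (G : SimpleGraph V) [G.LocallyFinite] {A : Type*}

/-- **THE FACE RESIDUE OF N2** ((F) column target): hp-8 g39's `FaceOblAtMF` (the face obligation at one face step with its own window map, (S0) kit rows, SkelPhiFaceResidueF) for
every ORIENTED run history whose chosen oriented candidate is `e`, valid, every FORWARD onward direction, every stub level `j < K` and every past edge set `o`, at the anchors
`(aOf₁O, aOf₂O)` — twin of N1's `FaceOblRM` (SkelNeg1ChoiceO :43). [cite: KozmaNitzan2024, §4 p. 30 (Step III)] -/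
def FaceOblRMOF (S : KSchA V A) (FD : FaceData V A) (Δ' : ℕ) (δ₂ : ℝ) : Prop :=
  ∀ h e, S.IsRun₂O G h → (S.astOf₂O G h).st.ochoice KSchA.qNE = some e → S.Valid₂O G h e →
    ∀ du ∈ S.onwardO G h (tgt e), ∀ j < S.Γ.K, ∀ o : Finset (Sym2 V), FaceOblAtMF G S FD Δ' δ₂ h e (S.aOf₁O G h e) (S.aOf₂O G h e) du j o

variable {G}

/-- **THE PACKAGING: root residue (forward, law-carrying) + face residue + corridor residue, (S0) kits throughout ⟹ `KitAtRunO`** — with the one-step property at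
`(δ₂ ↦ δc/2)` over `KitsAtF` steps of every window graph (faces, hp-8's `cond_of_faceOblAtMF`), the SOURCE-SEPARATED (S0) chain properties of every length `≤ nmax` in every
habitat window graph (corridors, `reach_of_reachOblAtHNF_src`) and of every length at `(δr n ↦ δc)` in every window graph (root, `rootOblF_of_rootOblTWF`).  Twin of N1's
`kitAtRun_of_oblRHNMW_src` (SkelNeg1ClosureA :125). [cite: KozmaNitzan2024, §4 (30), (32), Lemmas 10–12] -/
theorem kitAtRunO_of_oblRHNMWF_src {S : KSchA V A} {FD : FaceData V A} {nmax Δ' : ℕ} {δ δ₂ ε'' : ℝ} {δr : ℕ → ℝ}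
    (hstep : ∀ (c : V) (Rπ : ℕ) (Wg : Sym2 V → unitInterval) (s : KNLevels.TStep (winGraph G c Rπ)), s.KitsAtF Wg S.p Δ' δ₂ →
      1 - δ₂ < (prodBernoulli Wg).real s.L.reachB → 1 - S.δc / 2 < (prodBernoulli Wg).real (⋃ t ∈ s.T, openConn s.L.o t))
    (hchain : ∀ n ≤ nmax, ∀ (Ω : Finset V) (Wg : Sym2 V → unitInterval) (s : Fin (n + 1) → KNLevels.TStep (winGraphIn G Ω))
      (T' : Fin (n + 1) → Finset V) (η : ℝ),
      (∀ i : Fin (n + 1), (s i).L.o = (s 0).L.o) →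
      (∀ i : Fin n, T' (Fin.castSucc i) ⊆ (s i.succ).L.X 0) →
      (∀ i : Fin (n + 1), T' i ⊆ (s i).T) →
      (∀ i : Fin (n + 1), (s i).KitsAtF Wg S.p Δ' δ) →
      η ≤ δ / 2 →
      (∀ i : Fin (n + 1), (prodBernoulli Wg).real (⋃ t ∈ (s i).T \ T' i, openConn (s 0).L.o t) ≤ η) →
      1 - S.δc < (prodBernoulli Wg).real (s 0).L.reachB →
        1 - ε'' < (prodBernoulli Wg).real (⋃ t ∈ T' (Fin.last n), openConn (s 0).L.o t))
    (hchainr : ∀ (n : ℕ) (c : V) (Rπ : ℕ) (Wg : Sym2 V → unitInterval) (s : Fin (n + 1) → KNLevels.TStep (winGraph G c Rπ))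
      (T' : Fin (n + 1) → Finset V) (η : ℝ),
      (∀ i : Fin (n + 1), (s i).L.o = (s 0).L.o) →
      (∀ i : Fin n, T' (Fin.castSucc i) ⊆ (s i.succ).L.X 0) →
      (∀ i : Fin (n + 1), T' i ⊆ (s i).T) →
      (∀ i : Fin (n + 1), (s i).KitsAtF Wg S.p Δ' (δr n)) →
      η ≤ δr n / 2 →
      (∀ i : Fin (n + 1), (prodBernoulli Wg).real (⋃ t ∈ (s i).T \ T' i, openConn (s 0).L.o t) ≤ η) →
      1 - δr n < (prodBernoulli Wg).real (s 0).L.reachB →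
        1 - S.δc < (prodBernoulli Wg).real (⋃ t ∈ T' (Fin.last n), openConn (s 0).L.o t))
    (hQ0 : Skel.RootOblTWF G S Δ' δr) (hface : FaceOblRMOF G S FD Δ' δ₂) (hreach : Skel.ReachOblRHNOF G nmax S FD Δ' δ) :
    KSchA.KitAtRunO G S FD δ₂ ε'' := by
  refine And.intro (Skel.rootOblF_of_rootOblTWF hchainr hQ0) (And.intro ?_ ?_)
  · intro h e hrun hc hV du hdu j hj o hsrc
    exact cond_of_faceOblAtMF hstep (hface h e hrun hc hV du hdu j hj o) hsrc
  · intro h e hrun hc hV du hdu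
    exact Skel.reach_of_reachOblAtHNF_src hV hchain (hreach h e hrun hc hV du hdu)

end Skelφ

end Transplant

end Summit.CriticalPhenomena.PercolationContinuityZ3.Theorems

end
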